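import Literature.NumberTheory.Automorphic.CMPrincipalSeriesSpherical
import HarnessLib

/-!
# A spherical principal series of `U(σ, Φ_N)` has an UNRAMIFIED inducing character (converse of `CMPrincipalSeriesSpherical`)

★ `CMPrincipalSeriesSpherical.isSpherical_cmPrincipalSeries` proves: if `χ` is trivial on `T ∩ K_v` then `i_G(χ)^{K_v}` is a line.  This file
proves the CONVERSE direction, in the weak form that is actually used («a `K_v`-fixed vector forces `χ` unramified»):
* §1 (generic, `Ind_H^G σ` on the line `W = k`): if `G = H · K` and `Ind_H^G σ` has a non-zero `K`-fixed vector, then `σ(h) = 1` for every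
  `h ∈ H ∩ K` — a `K`-fixed `f` has `f(hκ) = σ(h) f(1)` (★ `toFun_eq_of_mem_fixedPoints`), so `f ≠ 0 ⇒ f(1) ≠ 0`, and
  `σ(h) f(1) = f(h) = f(1 · h) = f(1)` (★ `toFun_one_mem_fixedPoints_subgroupOf`);
* §2 (`G = U(σ, Φ_N)(R)`, ★ `principalSeries σ J hJ χ`): with `K` compact and `G = B · K`, a non-zero `K`-fixed vector of `i_G(χ)` forces
  `χ(t) = 1` for all `t ∈ T ∩ K` (`δ_B^{1/2} = 1` on `B ∩ K`, ★ `rootDeltaChar_borel_eq_one_of_mem_isCompact`; `proj t = t`, ★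
  `ParabolicTriple.proj_apply_of_mem_M`);
* §3 (CM carrier `U(Φ_N)(L⁺_v)`, `K_v = cmLocalIntegralLevel L N Φ_N v`, EVERY `N`, EVERY finite `v`):
  **`UnitaryGroup.eq_one_of_fixedPoints_cmPrincipalSeries_ne_bot (χ) (h : (cmPrincipalSeries L N v χ).fixedPoints K_v ≠ ⊥) (t) (ht : ↑t ∈ K_v) :
  χ t = 1`** and its `IsSpherical` form (Iwasawa `G = B · K_v` ★ `exists_borel_mul_mem_cmLocalIntegralLevel`, `K_v` compact open ★
  `isCompact_isOpen_cmLocalIntegralLevel`).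
[CartierCorvallis1979, §III.3, §IV.1: the `K`-fixed vectors of `Ind(χ)` are the functions `f(bk) = δ^{1/2}χ(b) f(1)`, non-zero only for `χ`
unramified] [Casselman1980, §3] [Rogawski1990, §4.5 p. 45; §12.2 pp. 173–174 (unramified `χ`, spherical constituents)].  With the Jacquet
embedding dichotomy (★ `Theorems/F0P3JacquetEmbeddingDichotomy`) this gives «a `K_v`-spherical non-supercuspidal irreducible representation of
`U(3)(L⁺_v)` embeds into an UNRAMIFIED principal series» (`Theorems/F0P3SphericalEmbedsUnramified`).  Theorems only; no definition, no named fact,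
no instance.  Cell `hodgecm-mathlib`, crux H413 (`--supports stmt-HodgeConjecture-24833`); HC_CM is proved only modulo the printed citations
until rung 0 closes.

## References
[CartierCorvallis1979] P. Cartier, *Representations of p-adic groups: a survey*, §III.3, §IV.1 · [Casselman1980] W. Casselman, *The unramified
principal series of p-adic groups I*, §3 · [Rogawski1990] §4.5 p. 45, §12.2 pp. 173–174.
-/

set_option autoImplicit false

noncomputable section

open scoped MatrixGroups
open NumberField IsDedekindDomain

namespace Literature.NumberTheory.Automorphic

/-! ## §1 Generic: a `K`-fixed vector of `Ind_H^G σ` on the line forces `σ = 1` on `H ∩ K` -/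

section Generic

variable {k G : Type*} [Field k] [Group G] [TopologicalSpace G] [SeparatelyContinuousMul G] {H K : Subgroup G}

/-- **A non-zero `K`-fixed vector of `Ind_H^G σ` (`σ` a character on the line `k`, `G = H · K`) forces `σ(h) = 1` for `h ∈ H ∩ K`**:
`f(hκ) = σ(h) f(1)` so `f(1) ≠ 0`, and `σ(h) f(1) = f(1)`. [cite: CartierCorvallis1979, §III.3] [cite: Rogawski1990, §4.5 p. 45] -/
theorem Representation.apply_eq_one_of_fixedPoints_smoothIndRep_ne_bot (σ : Representation k H k)
    (hGK : ∀ g : G, ∃ h : H, ∃ κ ∈ K, g = h * κ) (hne : (Representation.smoothIndRep H σ).fixedPoints K ≠ ⊥)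
    (h : H) (hh : (h : G) ∈ K) : σ h = 1 := by
  obtain ⟨f, hf, hf0⟩ := (Submodule.ne_bot_iff _).1 hne
  -- `f(1) ≠ 0`: a `K`-fixed vector with `f(1) = 0` vanishes identically (`G = H · K`)
  have h1 : f.toFun 1 ≠ 0 := by
    intro h0
    apply hf0
    exact Representation.eq_of_toFun_one_eq σ hGK hf (Submodule.zero_mem _) (by rw [h0]; rfl)
  -- `σ(h) f(1) = f(1)` for `h ∈ H ∩ K`
  have hfix := (σ.mem_fixedPoints (K.subgroupOf H) (f.toFun 1)).1 (Representation.toFun_one_mem_fixedPoints_subgroupOf H K σ hf) h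
    (Subgroup.mem_subgroupOf.2 hh)
  -- on the line `k`, a linear map fixing a non-zero vector is the identity
  apply LinearMap.ext_ring
  have hlin : σ h (f.toFun 1) = f.toFun 1 * σ h 1 := by
    rw [← smul_eq_mul, ← LinearMap.map_smul, smul_eq_mul, mul_one]
  rw [hlin] at hfix
  rw [Module.End.one_apply]
  exact mul_left_cancel₀ h1 (by rw [hfix, mul_one])

end Generic

namespace UnitaryGroup

/-! ## §2 `G = U(σ, Φ_N)(R)`: a `K`-fixed vector of `i_G(χ)` forces `χ = 1` on `T ∩ K` -/

section PS

variable {R : Type*} [CommRing R] (σ : R →+* R) {N : ℕ} (J : Matrix (Fin N) (Fin N) R) (hJ : J = (StdForm.antidiagonal N).over R)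
variable [TopologicalSpace R] [IsTopologicalRing R] [T1Space R] [LocallyCompactSpace ↥(borelU σ J)]

/-- **A `K`-fixed vector of `i_G(χ)` forces `χ` unramified** (`K` compact, `G = B · K`): `χ(t) = 1` for every `t ∈ T ∩ K`.  By §1 the inducing
character `δ_B^{1/2} · (χ ∘ proj)` is trivial on `B ∩ K`; at `t ∈ T ∩ K`, `δ_B^{1/2}(t) = 1` (★ `rootDeltaChar_borel_eq_one_of_mem_isCompact`)
and `proj t = t`. [cite: CartierCorvallis1979, §III.3, §IV.1] [cite: Rogawski1990, §4.5 p. 45; §12.2 pp. 173–174] -/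
theorem eq_one_of_fixedPoints_principalSeries_ne_bot {K : Subgroup ↥(unitaryGroupOfForm σ J)}
    (hKc : IsCompact (K : Set ↥(unitaryGroupOfForm σ J)))
    (hGK : ∀ g : ↥(unitaryGroupOfForm σ J), ∃ b : ↥(borelTriple σ J hJ).P, ∃ κ ∈ K, g = (b : ↥(unitaryGroupOfForm σ J)) * κ)
    (χ : ↥(torusU σ J) →* ℂˣ) (hne : (principalSeries σ J hJ χ).fixedPoints K ≠ ⊥)
    (t : ↥(torusU σ J)) (ht : (t : ↥(unitaryGroupOfForm σ J)) ∈ K) : χ t = 1 := by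
  -- `t` as an element of `B`
  let b : ↥(borelTriple σ J hJ).P := ⟨(t : ↥(unitaryGroupOfForm σ J)), torusU_le_borelU σ J t.2⟩
  have hb : (b : ↥(unitaryGroupOfForm σ J)) ∈ K := ht
  have hproj : (borelTriple σ J hJ).proj b = t := Subtype.ext ((borelTriple σ J hJ).proj_apply_of_mem_M b t.2)
  have key := Representation.apply_eq_one_of_fixedPoints_smoothIndRep_ne_bot
    (Representation.twist (((Representation.trivial ℂ ↥(torusU σ J) ℂ).twist χ).comp (borelTriple σ J hJ).proj)
      (rootDeltaChar (borelTriple σ J hJ).P)) hGK hne b hb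
  -- read off `χ(t) = 1` by applying to `1 ∈ ℂ`
  have h1 := LinearMap.congr_fun key (1 : ℂ)
  rw [Representation.twist_apply, rootDeltaChar_borel_eq_one_of_mem_isCompact σ J hJ hKc b hb, Units.val_one, one_smul,
    MonoidHom.comp_apply, Representation.twist_apply, hproj, Module.End.one_apply] at h1
  have h2 : ((χ t : ℂˣ) : ℂ) = 1 := by
    have htriv : (Representation.trivial ℂ ↥(torusU σ J) ℂ) t (1 : ℂ) = 1 := rfl
    rw [htriv, smul_eq_mul, mul_one] at h1
    exact h1
  exact Units.val_eq_one.1 h2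

end PS

/-! ## §3 The CM carrier `U(Φ_N)(L⁺_v)` with `K_v = U(Φ_N)(𝒪_v)` -/

section CM

variable (L : Type) [Field L] [NumberField L] [IsCMField L] (N : ℕ)
  (v : HeightOneSpectrum (𝓞 ↥(maximalRealSubfield L)))

/-- **`i_G(χ)^{K_v} ≠ 0` forces `χ` UNRAMIFIED** (`G = U(Φ_N)(L⁺_v)`, `K_v = cmLocalIntegralLevel L N Φ_N v`; every `N`, every finite `v`):
`χ(t) = 1` for every `t ∈ T ∩ K_v`.  Converse of ★ `isSpherical_cmPrincipalSeries`. [cite: CartierCorvallis1979, §IV.1] [cite: Casselman1980, §3]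
[cite: Rogawski1990, §12.2 pp. 173–174] -/
theorem eq_one_of_fixedPoints_cmPrincipalSeries_ne_bot
    (χ : ↥(torusU (conjLocal L (IsCMField.complexConj L) v) (cmLocalForm L N v)) →* ℂˣ)
    (hne : haveI := locallyCompactSpace_cmBorelU L N v
      (cmPrincipalSeries L N v χ).fixedPoints
        (cmLocalIntegralLevel L N (Matrix.of fun i j : Fin N => if i.val + j.val + 1 = N then (1 : L) else 0) v) ≠ ⊥)
    (t : ↥(torusU (conjLocal L (IsCMField.complexConj L) v) (cmLocalForm L N v)))
    (ht : (t : ↥(unitaryGroupOfForm (conjLocal L (IsCMField.complexConj L) v) (cmLocalForm L N v))) ∈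
      cmLocalIntegralLevel L N (Matrix.of fun i j : Fin N => if i.val + j.val + 1 = N then (1 : L) else 0) v) :
    χ t = 1 := by
  haveI := locallyCompactSpace_cmBorelU L N v
  have hK := isCompact_isOpen_cmLocalIntegralLevel L N (Matrix.of fun i j : Fin N => if i.val + j.val + 1 = N then (1 : L) else 0) v
  refine eq_one_of_fixedPoints_principalSeries_ne_bot (conjLocal L (IsCMField.complexConj L) v) (cmLocalForm L N v)
    (cmLocalForm_eq_over L N v) hK.1 (fun g => ?_) χ hne t ht
  obtain ⟨b, k, hk, hg⟩ := exists_borel_mul_mem_cmLocalIntegralLevel L N v g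
  exact ⟨b, k, hk, hg⟩

/-- The same from **`K_v`-sphericity** (`dim i_G(χ)^{K_v} = 1` ⇒ `i_G(χ)^{K_v} ≠ 0`). [cite: CartierCorvallis1979, §IV.1] [cite: Rogawski1990, §12.2 pp. 173–174] -/
theorem eq_one_of_isSpherical_cmPrincipalSeries
    (χ : ↥(torusU (conjLocal L (IsCMField.complexConj L) v) (cmLocalForm L N v)) →* ℂˣ)
    (hsph : haveI := locallyCompactSpace_cmBorelU L N v
      (cmPrincipalSeries L N v χ).IsSpherical
        (cmLocalIntegralLevel L N (Matrix.of fun i j : Fin N => if i.val + j.val + 1 = N then (1 : L) else 0) v))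
    (t : ↥(torusU (conjLocal L (IsCMField.complexConj L) v) (cmLocalForm L N v)))
    (ht : (t : ↥(unitaryGroupOfForm (conjLocal L (IsCMField.complexConj L) v) (cmLocalForm L N v))) ∈
      cmLocalIntegralLevel L N (Matrix.of fun i j : Fin N => if i.val + j.val + 1 = N then (1 : L) else 0) v) :
    χ t = 1 :=
  eq_one_of_fixedPoints_cmPrincipalSeries_ne_bot L N v χ hsph.isUnramified t ht

end CM

end UnitaryGroup

end Literature.NumberTheory.Automorphic

end
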